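import Summits.QuantumFields.QCD.Theses.SpectralDefectExtinction
import Summits.QuantumFields.QCD.Theorems.SpectralDefectExtinctionTipPricingStubCountMeasurable
import Literature.MathematicalPhysics.QuantumFieldTheory.QCDPhaseQuenched

/-!
# Stub `stub_negCountMeasurable` (S1) of line `free-volume-heavy-witness`
(crux `Summit.QuantumFields.QCD.Theses.SpectralDefectExtinction.WindowExtinction`, item
stmt-QuantumFields-8964)

Borel measurability, in the gauge field `U : GaugeConfig 4 n SU3`, of the negative-eigenvalue count
(with algebraic multiplicity, as `Multiset.countP (re < 0)` over the roots of the characteristic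
polynomial) of the Hermitian Wilson–Dirac operator `H(U) = Γ₅ D_W(U, m₀, 1)` (`SU(3)`, fundamental,
`r = 1`).  Without it every phase-quenched expectation `E₊ |n₋(Γ₅ D_W(U,−δ,1)) − n/2|` of the line
(a Bochner integral over `GaugeConfig 4 n SU3 = (TorusSite 4 n × Fin 4) → SU3` with the product Borel
σ-algebra) would be junk.

Proof: `U ↦ H(U)` is continuous (`continuous_wilsonDirac` for the continuous fundamental representation,
times the constant matrix `Γ₅ ⊗ 1` on the left), and the truth set `{re < 0}` of the counting predicate is
the increasing union of the closed half-planes `{re ≤ −1/(j+1)}`; so the general root-count measurability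
theorem `countMeas_measurable_countP` of the landed tree file
`Theorems/SpectralDefectExtinctionTipPricingStubCountMeasurable.lean` (upper semicontinuity of the
number of roots of `charpoly (A x)` in a closed set for continuous `A`, via continuity of the roots of a
monic polynomial in its coefficients; then `ℕ`-valued maps with measurable superlevel sets are
measurable) applies verbatim.  No new definitions; pure theorem file serving the lead's skeleton
`work/WindowExtinction.lean`.
-/

noncomputable section

namespace Summit.QuantumFields.QCD.Cruxes.WindowExtinction.FreeVolumeHeavyWitness

open scoped BigOperators Topology Classical
open Filter MeasureTheory Matrix
open Literature.MathematicalPhysics.QuantumLattice Literature.MathematicalPhysics.QuantumFieldTheory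
  Literature.Probability.LatticeModels
open Summit.QuantumFields.QCD.Cruxes.TipPricing.HermitianFlowCoarea

/-- **STUB S1 · `stub_negCountMeasurable`** — for every torus side `n` and bare mass `m₀`, the number of
roots `z` with `re z < 0` (with multiplicity) of the characteristic polynomial of the Hermitian Wilson–Dirac
operator `Γ₅ D_W(U, m₀, 1)` is a measurable function of the `SU(3)` gauge field `U`. -/
theorem stub_negCountMeasurable :
    ∀ (n : ℕ) [NeZero n] (m₀ : ℝ), Measurable fun U : GaugeConfig 4 n SU3 =>
      (spinorLift gammaFive * wilsonDirac (fundamentalRep (Fin 3)) U m₀ 1).charpoly.roots.countP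
        fun z : ℂ => z.re < 0 := by
  intro n _ m₀
  -- `U ↦ Γ₅ D_W(U, m₀, 1)` is continuous in the gauge field
  have hA : Continuous fun U : GaugeConfig 4 n SU3 =>
      spinorLift gammaFive * wilsonDirac (fundamentalRep (Fin 3)) U m₀ 1 :=
    continuous_const.matrix_mul
      (continuous_wilsonDirac _ (continuous_fundamentalRep (Fin 3)) m₀ 1)
  -- `{re < 0}` is exhausted by the closed half-planes `{re ≤ -1/(j+1)}`
  refine countMeas_measurable_countP hA (fun z : ℂ => z.re < 0)
    (fun j => {z : ℂ | z.re ≤ -(1 / ((j : ℝ) + 1))}) (fun j => ?_) (fun j k hjk => ?_) (fun z => ?_)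
  · exact isClosed_le Complex.continuous_re continuous_const
  · intro z hz
    simp only [Set.mem_setOf_eq] at hz ⊢
    have : (1 : ℝ) / (k + 1) ≤ 1 / (j + 1) :=
      one_div_le_one_div_of_le (by positivity) (by exact_mod_cast Nat.succ_le_succ hjk)
    linarith
  · constructor
    · intro h
      obtain ⟨j, hj⟩ := exists_nat_one_div_lt (neg_pos.mpr h)
      exact ⟨j, by simp only [Set.mem_setOf_eq]; linarith⟩
    · rintro ⟨j, hj⟩
      simp only [Set.mem_setOf_eq] at hj
      have : (0 : ℝ) < 1 / (j + 1) := by positivity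
      linarith

end Summit.QuantumFields.QCD.Cruxes.WindowExtinction.FreeVolumeHeavyWitness

end
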